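import Summits.CriticalPhenomena.PercolationContinuityZ3.Theorems.PercNearOneGluingAdditiveGluingExploreBFS
import Summits.CriticalPhenomena.PercolationContinuityZ3.Theorems.PercNearOneGluingAdditiveGluingLeafSystem
import HarnessLib

/-! # Crux `PercNearOneGluing.AdditiveGluing` (stmt-CriticalPhenomena-4576) — the BFS observer exploration: Theorem A and (SAU) ⇒ AdditiveGluing

Support file (`--supports stmt-CriticalPhenomena-4576`, cell `prim-png-dp-al5` gen 7; memo `EXPLORE-g7.md` §1–§3).  No `sorry`, no definitions.
Assembles the BFS leaf events of `…ExploreBFSDefs.lean` / `…ExploreBFS.lean` into a leaf system (`LeafSystem.*`) and proves: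
* `ExploreBFS.preFKG_of_hereditary` — **Theorem A**: a relay admissible at every non-empty contact leaf (e.g. the least `b`-reliable relay of
  `G − U` for every pre-contact blob `U`) satisfies Kozma–Nitzan's (41) `μ(o ↔ A, x̂ ↔ b) ≤ μ(o ↔ A, o ↔ b)` — for blobs `≡ {o}` this is KN Thm 4;
* `ExploreBFS.fail_le_sum_leaf` — the exploration transfer with the residual-worst designee;
* `ExploreBFS.additiveGluing_of_SAU` — **(SAU) ⇒ AdditiveGluing**, (SAU) = the memo's kernel verbatim; `ExploreBFS.additiveGluing_of_hereditary`.
[cite: KozmaNitzan2024, Lemma 5 (p. 13), Theorem 4 (pp. 12–14), Question 7 (p. 36)]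
-/

noncomputable section

namespace Summit.CriticalPhenomena.PercolationContinuityZ3.Theorems

open MeasureTheory Set
open Literature.Probability.LatticeModels (prodBernoulli)
open Literature.Probability.Percolation
open scoped BigOperators
open Classical

namespace ExploreBFS

variable {V : Type*}

/-! ### The BFS leaf system and the composition -/

section Assembly

variable [Fintype V]

omit [Fintype V] in
/-- The blob of a genuine leaf avoids the forbidden set. [this work] -/
theorem leafIdx_fst_subset {N : Set V} {o : V} (i : LeafIdx N o) : (↑i.1.1 : Set V) ⊆ Nᶜ := by
  obtain ⟨ω, hω⟩ := i.2
  rw [← hω.1]; exact blob_subset_compl N o ω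

/-- Every configuration lies in the leaf of `(blob, contacts)`. [this work] -/
theorem exists_leaf (N : Set V) (o : V) (ω : BondConfig V) :
    ∃ i : LeafIdx N o, ω ∈ leafEvent N o i.1 := by
  classical
  have hmem : ω ∈ leafEvent N o ((blob N o ω).toFinite.toFinset, (contacts N o ω).toFinite.toFinset) := by
    simp only [leafEvent, Set.Finite.coe_toFinset, mem_setOf_eq, and_self]
  exact ⟨⟨_, ⟨ω, hmem⟩⟩, hmem⟩

omit [Fintype V] in
/-- Distinct leaves are disjoint. [this work] -/
theorem disjoint_leaf (N : Set V) (o : V) (i j : LeafIdx N o) (hij : i ≠ j) :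
    Disjoint (leafEvent N o i.1) (leafEvent N o j.1) := by
  rw [Set.disjoint_left]
  rintro ω ⟨h1, h2⟩ ⟨h1', h2'⟩
  apply hij
  apply Subtype.ext
  refine Prod.ext (Finset.coe_injective ?_) (Finset.coe_injective ?_)
  · exact h1.symm.trans h1'
  · exact h2.symm.trans h2'

omit [Fintype V] in
/-- On a leaf whose contact set misses `A ∪ {b}`, the observer misses `A`. [this work] -/
theorem dead_leaf {A : Finset V} {o b : V} (hoN : o ∉ (↑A ∪ {b} : Set V)) {p : Finset V × Finset V}
    (hbB : b ∉ (↑p.2 : Set V)) (hAB : ∀ a ∈ A, a ∉ (↑p.2 : Set V)) :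
    leafEvent (↑A ∪ {b}) o p ⊆ (⋃ a ∈ A, (openConn o a : Set (BondConfig V)))ᶜ := by
  intro ω hω hoa
  simp only [mem_iUnion, exists_prop] at hoa
  obtain ⟨a, ha, hreach⟩ := hoa
  have hfree : ∀ z ∈ (↑A ∪ {b} : Set V), z ∉ contacts (↑A ∪ {b}) o ω := by
    intro z hz hzc
    rw [hω.2] at hzc
    rcases hz with hz | hz
    · exact hAB z hz hzc
    · rw [mem_singleton_iff] at hz; subst hz; exact hbB hzc
  exact not_reachable_of_contacts_free hoN hfree a (Or.inl ha) hreach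

/-- **Kozma–Nitzan's (41) at a hereditarily admissible relay — concrete BFS form (Theorem A of the memo).**
Let `o ∉ A`, `o ≠ b`.  If a relay `x̂ ∈ A` is, for every pair `(U, B)` whose leaf `{blob = U, contacts = B}` (forbidden set `A ∪ {b}`)
is a non-empty contact leaf (`B` meets `A` and misses `b`), at most as `b`-reliable in `G − U` as some vertex of `B ∖ U`, then
`μ(o ↔ A, x̂ ↔ b) ≤ μ(o ↔ A, o ↔ b)`.  Sufficient: `x̂` is the least `b`-reliable relay in `G − U` for every blob `U` (take the
relay in `B`).  For `U ≡ {o}` (no free neighbours) this is Kozma–Nitzan's Theorem 4.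
[cite: KozmaNitzan2024, Theorem 4 (pp. 12–14), Question 7 (p. 36)] -/
theorem preFKG_of_hereditary (w : Sym2 V → unitInterval) (A : Finset V) (o b xh : V)
    (hoA : o ∉ A) (hob : o ≠ b) (hxh : xh ∈ A)
    (hadm : ∀ p : Finset V × Finset V, (leafEvent (↑A ∪ {b}) o p).Nonempty → b ∉ (↑p.2 : Set V) →
      (∃ a ∈ A, a ∈ (↑p.2 : Set V)) →
      ∃ v ∈ (↑p.2 : Set V), v ∉ (↑p.1 : Set V) ∧
        (prodBernoulli w).real (openConnIn (↑p.1 : Set V)ᶜ xh b) ≤ (prodBernoulli w).real (openConnIn (↑p.1 : Set V)ᶜ v b)) :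
    (prodBernoulli w).real ((⋃ a ∈ A, openConn o a) ∩ openConn xh b) ≤
      (prodBernoulli w).real ((⋃ a ∈ A, openConn o a) ∩ openConn o b) := by
  classical
  set N : Set V := ↑A ∪ {b} with hN
  have hoN : o ∉ N := by
    rintro (h | h)
    · exact hoA h
    · exact hob h
  have hbN : b ∈ N := Or.inr rfl
  refine LeafSystem.preFKG_of_leafSystem w A o b xh (ι := LeafIdx N o)
    (fun i => (↑i.1.1 : Set V)) (fun i => (↑i.1.2 : Set V)) (fun i => leafEvent N o i.1)
    (disjoint_leaf N o) (exists_leaf N o) ?_ ?_ ?_ ?_ ?_ ?_ hxh ?_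
  · intro i hb; exact leafIdx_fst_subset i hb hbN
  · intro i a ha haU; exact leafIdx_fst_subset i haU (Or.inl ha)
  · intro i; exact determinedBy_leaf N o _ _
  · intro i ω hω; exact star_of_leaf hω
  · intro i ω hω; exact join_of_leaf hω
  · intro i hbB hAB; exact dead_leaf hoN hbB hAB
  · intro i hbB hAB; exact hadm i.1 i.2 hbB hAB

/-- **The exploration transfer with the residual-worst designee (memo §1/§3).**  With `sel (U, B) ∈ A` a least `b`-reliable relay of
`G − U` (any choice), `μ(o ↔ A, o ↮ b) ≤ Σ_{(U,B) ∈ T} μ({blob = U, contacts = B} ∩ {sel(U,B) ↮ b})`, `T` = the contact pairs (`B ∌ b`, `B ∩ A ≠ ∅`; any finset with this membership).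
[cite: KozmaNitzan2024, Lemma 5 (p. 13)] -/
theorem fail_le_sum_leaf (w : Sym2 V → unitInterval) (A : Finset V) (o b : V) (hoA : o ∉ A) (hob : o ≠ b)
    (sel : Finset V × Finset V → V) (hsel : ∀ p, sel p ∈ A)
    (hmin : ∀ p, ∀ a ∈ A, (prodBernoulli w).real (openConnIn (↑p.1 : Set V)ᶜ (sel p) b) ≤
      (prodBernoulli w).real (openConnIn (↑p.1 : Set V)ᶜ a b))
    (T : Finset (Finset V × Finset V)) (hT : ∀ p, p ∈ T ↔ (b ∉ p.2 ∧ ∃ a ∈ A, a ∈ p.2)) :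
    (prodBernoulli w).real ((⋃ a ∈ A, openConn o a) ∩ (openConn o b)ᶜ) ≤
      ∑ p ∈ T, (prodBernoulli w).real (leafEvent (↑A ∪ {b}) o p ∩ (openConn (sel p) b)ᶜ) := by
  classical
  set N : Set V := ↑A ∪ {b} with hN
  have hoN : o ∉ N := by
    rintro (h | h)
    · exact hoA h
    · exact hob h
  have hbN : b ∈ N := Or.inr rfl
  set S : Finset (LeafIdx N o) := Finset.univ.filter (fun i => b ∉ (↑i.1.2 : Set V) ∧ ∃ a ∈ A, a ∈ (↑i.1.2 : Set V)) with hS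
  have step := LeafSystem.fail_le_of_leafSystem w A o b (ι := LeafIdx N o)
    (fun i => (↑i.1.1 : Set V)) (fun i => (↑i.1.2 : Set V)) (fun i => leafEvent N o i.1) (fun i => sel i.1)
    (disjoint_leaf N o) (exists_leaf N o)
    (fun i hb => leafIdx_fst_subset i hb hbN) (fun i a ha haU => leafIdx_fst_subset i haU (Or.inl ha))
    (fun i => determinedBy_leaf N o _ _) (fun i ω hω => star_of_leaf hω) (fun i ω hω => join_of_leaf hω)
    (fun i hbB hAB => dead_leaf hoN hbB hAB) (fun i => hsel i.1)
    (fun i hbB hAB => by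
      obtain ⟨a, ha, haB⟩ := hAB
      exact ⟨a, haB, fun haU => leafIdx_fst_subset i haU (Or.inl ha), hmin i.1 a ha⟩)
    S (fun i => by rw [hS, Finset.mem_filter]; exact ⟨fun h => h.2, fun h => ⟨Finset.mem_univ i, h⟩⟩)
  refine step.trans ?_
  -- compare the sum over genuine leaves with the sum over all pairs (extra terms are nonnegative)
  have hinj : ∑ i ∈ S, (prodBernoulli w).real (leafEvent N o i.1 ∩ (openConn (sel i.1) b)ᶜ) =
      ∑ p ∈ S.map (Function.Embedding.subtype _),
        (prodBernoulli w).real (leafEvent N o p ∩ (openConn (sel p) b)ᶜ) := by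
    rw [Finset.sum_map]; rfl
  rw [hinj]
  refine Finset.sum_le_sum_of_subset_of_nonneg ?_ (fun _ _ _ => measureReal_nonneg)
  intro p hp
  rw [Finset.mem_map] at hp
  obtain ⟨i, hi, rfl⟩ := hp
  rw [hS, Finset.mem_filter] at hi
  rw [hT]
  refine ⟨?_, ?_⟩
  · exact fun h => hi.2.1 (Finset.mem_coe.2 h)
  · obtain ⟨a, ha, haB⟩ := hi.2.2
    exact ⟨a, ha, Finset.mem_coe.1 haB⟩

end Assembly

end ExploreBFS

/-! ### Crux packaging -/

/-- **(SAU) ⇒ `AdditiveGluing`** — the memo's kernel, verbatim: for every instance (`o, b ∉ A`, `o ≠ b`, `0 ≤ t`, `1 − t ≤ μ(a ↔ b)` on `A`)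
and SOME choice `sel (U, B) ∈ A` of a least `b`-reliable relay of `G − U` for every pair `(U, B)`, the contact-leaf failure sum of the
BFS observer exploration (forbidden set `A ∪ {b}`) is at most `t` (instances with `o, b ∉ A`, `o ≠ b`, `A ≠ ∅`, `0 ≤ t`,
`1 − t ≤ μ(a ↔ b)` on `A`):
`Σ_{(U,B): B ∌ b, B ∩ A ≠ ∅} μ({blob = U, contacts = B} ∩ {sel(U,B) ↮ b}) ≤ t`.  Then the crux decl holds.
(Census form (SAU) of EXPLORE-g7.md §3: the sum is `≤ max_a μ(a ↮ b) ≤ t`.) [cite: KozmaNitzan2024, Lemma 5 (p. 13)] -/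
theorem ExploreBFS.additiveGluing_of_SAU
    (hSAU : ∀ (n : ℕ) (w : Sym2 (Fin n) → unitInterval) (A : Finset (Fin n)) (o b : Fin n) (t : ℝ),
      o ∉ A → b ∉ A → o ≠ b → A.Nonempty → 0 ≤ t → (∀ a ∈ A, 1 - t ≤ (prodBernoulli w).real (openConn a b)) →
      ∃ sel : Finset (Fin n) × Finset (Fin n) → Fin n,
        (∀ p, sel p ∈ A) ∧
        (∀ p, ∀ a ∈ A, (prodBernoulli w).real (openConnIn (↑p.1 : Set (Fin n))ᶜ (sel p) b) ≤
          (prodBernoulli w).real (openConnIn (↑p.1 : Set (Fin n))ᶜ a b)) ∧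
        (∑ p ∈ (Finset.univ : Finset (Finset (Fin n) × Finset (Fin n))).filter (fun p => b ∉ p.2 ∧ ∃ a ∈ A, a ∈ p.2),
          (prodBernoulli w).real (ExploreBFS.leafEvent (↑A ∪ {b}) o p ∩ (openConn (sel p) b)ᶜ)) ≤ t) :
    Theses.PercNearOneGluing.AdditiveGluing := by
  classical
  refine LeafSystem.additiveGluing_of_failBound fun n w A o b t hoA hbA hob ht hrel => ?_
  by_cases hAe : A = ∅
  · have h0 : (⋃ a ∈ A, (openConn o a : Set (BondConfig (Fin n)))) ∩ (openConn o b)ᶜ = ∅ := by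
      ext ω; simp [hAe]
    rw [h0, measureReal_empty]; exact ht
  obtain ⟨sel, hsel, hmin, hsum⟩ := hSAU n w A o b t hoA hbA hob (Finset.nonempty_iff_ne_empty.2 hAe) ht hrel
  exact (ExploreBFS.fail_le_sum_leaf w A o b hoA hob sel hsel hmin _
    (fun p => by rw [Finset.mem_filter]; exact ⟨fun h => h.2, fun h => ⟨Finset.mem_univ p, h⟩⟩)).trans hsum

/-- **Theorem A, crux form**: if in every instance (`o, b ∉ A`, `o ≠ b`, `A ≠ ∅`) some relay is admissible at every non-empty contact leaf
of the BFS observer exploration (e.g. one relay is the least `b`-reliable in `G − U` for every blob `U`), then `AdditiveGluing`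
(via (41) at that relay, Harris, and the union bound). [cite: KozmaNitzan2024, Theorem 4 (pp. 12–14)] -/
theorem ExploreBFS.additiveGluing_of_hereditary
    (hA : ∀ (n : ℕ) (w : Sym2 (Fin n) → unitInterval) (A : Finset (Fin n)) (o b : Fin n),
      o ∉ A → b ∉ A → o ≠ b → A.Nonempty → ∃ xh ∈ A,
        ∀ p : Finset (Fin n) × Finset (Fin n), (ExploreBFS.leafEvent (↑A ∪ {b}) o p).Nonempty → b ∉ (↑p.2 : Set (Fin n)) →
          (∃ a ∈ A, a ∈ (↑p.2 : Set (Fin n))) →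
          ∃ v ∈ (↑p.2 : Set (Fin n)), v ∉ (↑p.1 : Set (Fin n)) ∧
            (prodBernoulli w).real (openConnIn (↑p.1 : Set (Fin n))ᶜ xh b) ≤
              (prodBernoulli w).real (openConnIn (↑p.1 : Set (Fin n))ᶜ v b)) :
    Theses.PercNearOneGluing.AdditiveGluing := by
  classical
  refine LeafSystem.additiveGluing_of_failBound fun n w A o b t hoA hbA hob ht hrel => ?_
  set μ := prodBernoulli w with hμ
  set OA : Set (BondConfig (Fin n)) := ⋃ a ∈ A, openConn o a with hOA
  by_cases hAe : A = ∅
  · have h0 : OA ∩ (openConn o b)ᶜ = ∅ := by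
      ext ω; simp [hOA, hAe]
    rw [h0, measureReal_empty]; exact ht
  obtain ⟨xh, hxh, hadm⟩ := hA n w A o b hoA hbA hob (Finset.nonempty_iff_ne_empty.2 hAe)
  have h41 := ExploreBFS.preFKG_of_hereditary w A o b xh hoA hob hxh hadm
  have hup : IsUpperSet OA := by
    intro ω ω' hle hω
    simp only [hOA, mem_iUnion, exists_prop] at hω ⊢
    obtain ⟨a, ha, h⟩ := hω
    exact ⟨a, ha, isUpperSet_openConn o a hle h⟩
  have harris := Literature.Probability.LatticeModels.prodBernoulli_harris w hup (isUpperSet_openConn xh b)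
    MeasurableSet.of_discrete MeasurableSet.of_discrete
  have hsplit : μ.real OA = μ.real (OA ∩ openConn o b) + μ.real (OA ∩ (openConn o b)ᶜ) := by
    rw [← measureReal_inter_add_sdiff (s := OA) (MeasurableSet.of_discrete : MeasurableSet (openConn o b : Set _))
      (h := measure_ne_top _ _), Set.sdiff_eq]
  have hx := hrel xh hxh
  have hOA1 : μ.real OA ≤ 1 := measureReal_le_one
  have hOA0 : 0 ≤ μ.real OA := measureReal_nonneg
  nlinarith [mul_le_mul_of_nonneg_left hx hOA0]

end Summit.CriticalPhenomena.PercolationContinuityZ3.Theorems
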